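import Summits.ResolutionOfSingularities.ResolutionOfSingularities.Theorems.DeltaCutStellarHypFibreData
import Summits.ResolutionOfSingularities.ResolutionOfSingularities.Theorems.DeltaCutStellarGuard

/-!
# StellarCut T12 — «HypFibre»: THE TAME GUARD — over the centre, the transform has order `≤ 1` off `V(H')`
# (the support half of the hypersurface round lemma; this is where `¬ p ∣ n` bites; lens-6, g33; 0-weight)

Fix a `ncHypShape n`-datum `M` for `(E, H)` with `HasSNC (H :: boundaryOf E)` and the blow-up `π` of a face `C = Σ_T K` through
`H` of weight `≥ n` (`DeltaCutStellarHypPersist`).  MAIN (`ncHypShape.not_stalkIdeal_transform_le_sq`): at every point `x'` of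
the exceptional divisor NOT on `V(H')` — closed or not, over ANY residue field — `𝓘'_{x'} ⊄ 𝔪_{x'}²`, i.e. `ord_{x'} 𝓘' ≤ 1`.
Consequently (T13) `supp M' ⊆ V(H')` when `n ≥ 2`.

PROOF = the near-point order bound [CoP1] Prop. 4.2 (a) in its sharp Literature-level form `DeltaCutStellarNearPoint` (T10c), fed
with EXPLICIT data read off the frame at `y = π x'` (`ncHypShape.exists_fibre_data`): the centre parameters `c = (z_K)_{K ∈ T}`
are the labelled members of one regular system of parameters (`exists_isRsopPart_lab`; quasi-regular by Matsumura 16.2 (i)), the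
contact parameter is `c_{l_H}`, and a generator of `𝓘_y` is `eval c F` for the degree-`n` FORM
`F = X_{l_H}ⁿ + a·X^b` — here `𝓜(E)_y = ∏ z_K^{a_K}` (`stalkIdeal_monomialIdeal_eq_span_prod`), the `T`-part regroups as
`∏_{l} c_l^{A_l}` with `Σ A = weightOf E T ≥ n` and `A_{l_H} = 0` (label clause), and `b ≤ A` is any exponent vector of total
degree `n` (so `b_{l_H} = 0`); the cofactor `a` collects the unit, `c^{A−b}` and the off-`T` factors.  On the chart `D₊(c_{l_H})`
the dehomogenised reduced form is `1 + ā·X^b` and SOME `b_l` is a unit in the residue field BECAUSE `Σ b_l = n` IS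
(`¬ p ∣ n` ⇒ `n ∈ 𝒪^×`; `exists_isUnit_natCast_of_isUnit_sum`) — Guard `algebraMap_one_add_monomial_notMem_sq`; on a chart
`D₊(c_j)`, `j ≠ l_H`, off `V(H')` the variable `X_{l_H}` is inverted and the form is `X_{l_H}ⁿ + ā·X^b` with `n` a unit — Guard
`algebraMap_X_pow_add_monomial_notMem_sq`.  [CoP1]'s fibre computation then bounds the order of the controlled transform by `1`.

WILD failure recorded (why `¬ p ∣ n` is load-bearing): for `x² + (1+xz)·z²w²`, `p = n = 2`, the reduced form on `D₊(z)` at the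
point `x' = w = 1` of the exceptional divisor is a SQUARE and the transform has order `2` off `V(H')` (T8 docstring); TAME desk
inhabitant `x³ + (1+xz)·z³w³`, char `2`, `n = 3`.  0 sorry; axioms standard. [new]
[cite: CossartPiltant2008, Prop. 4.2 (a)] [cite: Matsumura1987, Thm. 16.2 (i)] [cite: Kollar2007, (3.111) Step 3]
-/

noncomputable section

open CategoryTheory CategoryTheory.Limits AlgebraicGeometry TopologicalSpace IsLocalRing
open Literature.AlgebraicGeometry.Resolution

namespace Summit.ResolutionOfSingularities.ResolutionOfSingularities.Theorems.DeltaCutClasses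

open Summit.ResolutionOfSingularities.ResolutionOfSingularities.Theorems

section Fibre

variable {X X' : Scheme.{0}} [IsLocallyNoetherian X] {π : X' ⟶ X} {H : X.IdealSheafData}
  {E : List (X.IdealSheafData × ℕ)} {T : Finset X.IdealSheafData} {n : ℕ} {M : MarkedIdeal X}

omit [IsLocallyNoetherian X] in
/-- **The fibre form at a point of the centre.**  At `y ∈ V(C)`, `C = Σ_T K` a face through `H` of weight `≥ n` of a
`ncHypShape n`-datum: centre parameters `c` (part of a regular system of parameters, spanning `C_y`, `H_y = (c l_H)`), an exponent
vector `b` of degree `n` with `b l_H = 0`, and a cofactor `a` such that `eval c (X_{l_H}ⁿ + a·X^b) ∈ 𝓘_y` (module docstring).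
[new] [cite: CossartPiltant2008, proof of Prop. 4.2 (a)] [cite: Kollar2007, (3.111) Step 3] -/
theorem ncHypShape.exists_fibre_data (hEs : HasSNC (H :: boundaryOf E)) (hT : ∀ K ∈ T, K ∈ H :: boundaryOf E) (hHT : H ∈ T)
    (hmT : n ≤ weightOf E T) (hP : ncHypShape n X E H M) {y : X} (hy : y ∈ (T.sup id).support) :
    ∃ (k : ℕ) (c : Fin k → X.presheaf.stalk y) (lH : Fin k) (b : Fin k →₀ ℕ) (a : X.presheaf.stalk y),
      IsRsopPart c ∧ Ideal.span (Set.range c) = stalkIdeal (T.sup id) y ∧ stalkIdeal H y = Ideal.span {c lH} ∧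
      b lH = 0 ∧ b.degree = n ∧
      MvPolynomial.eval c (MvPolynomial.X lH ^ n + MvPolynomial.monomial b a) ∈ stalkIdeal M.ideal y := by
  classical
  haveI : IsRegularLocalRing (X.presheaf.stalk y) := (hEs y).1
  haveI : IsDomain (X.presheaf.stalk y) := isDomain_of_isRegularLocalRing _
  have hyT : ∀ K ∈ T, y ∈ K.support := (mem_support_finsetSup_iff T y).mp hy
  have hyH : y ∈ H.support := hyT H hHT
  obtain ⟨d, z, lab, hz, hlab, hinj⟩ := exists_isRsopPart_lab hEs List.mem_cons_self hyH
  -- the centre parameters `c = z ∘ e`, `e l = lab (σT⁻¹ l)`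
  set σT := T.equivFin with hσT
  let e : Fin T.card → Fin d := fun l => lab (σT.symm l).1
  have he : Function.Injective e := fun l₁ l₂ h =>
    σT.symm.injective (Subtype.ext (hinj _ (hT _ (σT.symm l₁).2) _ (hT _ (σT.symm l₂).2)
      (hyT _ (σT.symm l₁).2) (hyT _ (σT.symm l₂).2) h))
  have hce : ∀ K : ↥T, (z ∘ e) (σT K) = z (lab K.1) := fun K => by
    simp only [Function.comp_apply, e, Equiv.symm_apply_apply]
  have hspan : Ideal.span (Set.range (z ∘ e)) = stalkIdeal (T.sup id) y := by
    rw [stalkIdeal_finsetSup T y]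
    have hsup : (T.sup fun K => stalkIdeal K y) = T.sup fun K => Ideal.span {z (lab K)} :=
      Finset.sup_congr rfl fun K hK => hlab K (hT K hK) (hyT K hK)
    rw [hsup, Finset.sup_span_singleton_eq_span_image]
    congr 1
    ext a
    constructor
    · rintro ⟨l, rfl⟩
      exact ⟨(σT.symm l).1, (σT.symm l).2, rfl⟩
    · rintro ⟨K, hK, rfl⟩
      exact ⟨σT ⟨K, hK⟩, hce ⟨K, hK⟩⟩
  set lH := σT ⟨H, hHT⟩ with hlH
  have hHc : stalkIdeal H y = Ideal.span {(z ∘ e) lH} := by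
    rw [hce ⟨H, hHT⟩]; exact hlab H List.mem_cons_self hyH
  -- the generators of the datum, the monomial as a product of parameters
  obtain ⟨h, m, u, -, hHx, hMx, hIx⟩ := hP.exists_generator hyH
  have hE : ∀ p ∈ E, p.1 ∈ H :: boundaryOf E := fun p hp => List.mem_cons_of_mem _ (fst_mem_boundaryOf hp)
  set g : X.IdealSheafData × ℕ → X.presheaf.stalk y := fun p => if y ∈ p.1.support then z (lab p.1) ^ p.2 else 1 with hg
  set gT : X.IdealSheafData × ℕ → X.presheaf.stalk y := fun p => if p.1 ∈ T then z (lab p.1) ^ p.2 else 1 with hgT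
  set gO : X.IdealSheafData × ℕ → X.presheaf.stalk y := fun p => if p.1 ∈ T then 1 else g p with hgO
  have hm₀ : stalkIdeal (monomialIdeal E) y = Ideal.span {(E.map g).prod} :=
    stalkIdeal_monomialIdeal_eq_span_prod hlab E hE
  have hsplit : (E.map g).prod = (E.map gT).prod * (E.map gO).prod := by
    rw [← List.prod_map_mul]
    congr 1
    refine List.map_congr_left fun p hp => ?_
    by_cases hp1 : p.1 ∈ T
    · simp only [hg, hgT, hgO, if_pos hp1, if_pos (hyT _ hp1), mul_one]
    · simp only [hgT, hgO, if_neg hp1, one_mul]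
  set A : Fin T.card → ℕ := fun l => expOf E (σT.symm l).1 with hA
  have hTprod : (E.map gT).prod = ∏ l, (z ∘ e) l ^ A l := by
    rw [hgT, prod_map_pow_ite_mem_eq E T (fun K => z (lab K)),
      ← Finset.prod_coe_sort T (fun K => z (lab K) ^ expOf E K)]
    exact Fintype.prod_equiv σT _ _ fun K => by rw [hce K]; simp only [hA, Equiv.symm_apply_apply]
  have hAsum : ∑ l, A l = weightOf E T := by
    rw [← sum_expOf_eq_weightOf E T, ← Finset.sum_coe_sort T (fun K => expOf E K)]
    exact (Fintype.sum_equiv σT (fun K : ↥T => expOf E K.1) A fun K => by simp only [hA, Equiv.symm_apply_apply]).symm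
  have hAlH : A lH = 0 := by
    simp only [hA, hlH, Equiv.symm_apply_apply]
    exact expOf_eq_zero_of_labels fun q hq hqH =>
      (hP.label_eq_zero hq hqH).resolve_right (Set.nonempty_iff_ne_empty.mp ⟨y, hyH⟩)
  -- the exponent vector `b ≤ A` of degree `n`
  obtain ⟨B, hBA, hBsum⟩ := exists_le_sum_eq A (r := n) (hAsum ▸ hmT)
  have hBlH : B lH = 0 := Nat.eq_zero_of_le_zero (hAlH ▸ hBA lH)
  have hAB : ∏ l, (z ∘ e) l ^ A l = (∏ l, (z ∘ e) l ^ B l) * ∏ l, (z ∘ e) l ^ (A l - B l) := by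
    rw [← Finset.prod_mul_distrib]
    exact Finset.prod_congr rfl fun l _ => by rw [← pow_add, Nat.add_sub_cancel' (hBA l)]
  -- normalise the generators: `h ~ c l_H`, `m ~ ∏ g`
  obtain ⟨w, hw⟩ := Ideal.span_singleton_eq_span_singleton.mp (hHx.symm.trans hHc)
  obtain ⟨w', hw'⟩ := Ideal.span_singleton_eq_span_singleton.mp (hm₀.symm.trans hMx)
  set b : Fin T.card →₀ ℕ := Finsupp.equivFunOnFinite.symm B with hb
  have hbB : ∀ l, b l = B l := fun l => rfl
  refine ⟨T.card, z ∘ e, lH, b, ↑w ^ n * u * ↑w' * (∏ l, (z ∘ e) l ^ (A l - B l)) * (E.map gO).prod, hz.comp e he, hspan,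
    hHc, by rw [hbB, hBlH], by rw [Finsupp.degree_eq_sum]; simp only [hbB, hBsum], ?_⟩
  have hprod : (b.prod fun l k => (z ∘ e) l ^ k) = ∏ l, (z ∘ e) l ^ B l := by
    rw [Finsupp.prod_fintype _ _ fun l => pow_zero _]
    exact Finset.prod_congr rfl fun l _ => by rw [hbB]
  have hkey : MvPolynomial.eval (z ∘ e) (MvPolynomial.X lH ^ n + MvPolynomial.monomial b
      (↑w ^ n * u * ↑w' * (∏ l, (z ∘ e) l ^ (A l - B l)) * (E.map gO).prod)) = ↑w ^ n * (h ^ n + u * m) := by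
    rw [map_add, map_pow, MvPolynomial.eval_X, MvPolynomial.eval_monomial, hprod, mul_add, ← mul_pow, mul_comm _ h, hw,
      ← hw', hsplit, hTprod, hAB]
    ring
  rw [hkey, hIx]
  exact Ideal.mul_mem_left _ _ (Ideal.mem_span_singleton_self _)

/-- **Off `V(H')`, the pulled-back centre is generated by the pulled-back contact parameter**: `π^*C_y · 𝒪_{x'} = (π^* c_{l_H})`
at `x' ∉ V(H')` (total transform of `H` = `H' + F`, and `H'` is a unit at `x'`). [cite: Kollar2007, (3.111) Step 3] -/
theorem map_stalkIdeal_finsetSup_eq_span_of_not_mem (hEs : HasSNC (H :: boundaryOf E)) (hT : ∀ K ∈ T, K ∈ H :: boundaryOf E)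
    (hHT : H ∈ T) (hπ : IsBlowup π (T.sup id)) {x' : X'} (hx' : x' ∉ (strictTransformIdeal π (T.sup id) H).support)
    {a : X.presheaf.stalk (π x')} (hHa : stalkIdeal H (π x') = Ideal.span {a}) :
    (stalkIdeal (T.sup id) (π x')).map (π.stalkMap x').hom = Ideal.span {(π.stalkMap x').hom a} := by
  haveI : IsProper π := hπ.isProper
  haveI : IsLocallyNoetherian X' := LocallyOfFiniteType.isLocallyNoetherian π
  have h1 := map_stalkIdeal_eq_mul_of_mem hEs hT hπ hHT x'
  rw [hHa, Ideal.map_span, Set.image_singleton, stalkIdeal_eq_top_of_not_mem_support hx', Ideal.top_mul,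
    stalkIdeal_comap_eq_map_stalkMap] at h1
  exact h1.symm

set_option maxHeartbeats 800000 in
/-- **The reduced dehomogenised fibre form has order `≤ 1` on every chart** — the `hg`-input of the near-point bound for
`F = X_{l_H}ⁿ + a X^b` (`R` local, `n ∈ R^×`, `b l_H = 0`, `deg b = n`): SOME `b_{l₁}`, `l₁ ≠ l_H`, is a unit because `deg b`
is; on `D₊(c_{l_H})` the form is `1 + ā X^{b}` (Guard (i), `∂/∂X_{l₁}`); on `D₊(c_j)`, `j ≠ l_H`, at primes not containing
`X_{l_H}` it is `X_{l_H}ⁿ + ā X^{b}` (Guard (ii), `∂/∂X_{l_H}`). [new] [cite: CossartPiltant2008, proof of Prop. 4.2 (a)] -/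
theorem fibreForm_notMem_sq {R : Type*} [CommRing R] [IsLocalRing R] {k n : ℕ} (hn : IsUnit ((n : ℕ) : R)) (lH : Fin k)
    (b : Fin k →₀ ℕ) (hblH : b lH = 0) (hbn : b.degree = n) (a : R) (j : Fin k)
    (𝔮 : Ideal (MvPolynomial {l : Fin k // l ≠ j} (R ⧸ maximalIdeal R))) [𝔮.IsPrime]
    (h𝔮 : ∀ l : {l : Fin k // l ≠ j}, l.1 ∈ ({lH} : Set (Fin k)) →
      (MvPolynomial.X l : MvPolynomial {l : Fin k // l ≠ j} (R ⧸ maximalIdeal R)) ∉ 𝔮) :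
    algebraMap _ (Localization.AtPrime 𝔮) (MvPolynomial.map (Ideal.Quotient.mk (maximalIdeal R))
      (dehomogenize j (MvPolynomial.X lH ^ n + MvPolynomial.monomial b a))) ∉ maximalIdeal (Localization.AtPrime 𝔮) ^ 2 := by
  classical
  -- `n = deg b` is a unit, hence so is some `b_{l₁}`, `l₁ ≠ l_H` — in `R`, then in the residue field
  obtain ⟨l₁, hl₁, hbl₁⟩ := exists_ne_isUnit_natCast_of_isUnit_degree b hblH (by rw [hbn]; exact hn)
  have hnκ : IsUnit ((n : ℕ) : R ⧸ maximalIdeal R) := by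
    simpa only [map_natCast] using hn.map (Ideal.Quotient.mk (maximalIdeal R))
  have hbl₁κ : IsUnit ((b l₁ : ℕ) : R ⧸ maximalIdeal R) := by
    simpa only [map_natCast] using hbl₁.map (Ideal.Quotient.mk (maximalIdeal R))
  have hF : MvPolynomial.map (Ideal.Quotient.mk (maximalIdeal R))
      (dehomogenize j (MvPolynomial.X lH ^ n + MvPolynomial.monomial b a)) = killVar j lH ^ n +
        MvPolynomial.monomial (b.subtypeDomain fun l => l ≠ j) (Ideal.Quotient.mk (maximalIdeal R) a) := by
    rw [map_dehomogenize, map_add, map_pow, MvPolynomial.map_X, MvPolynomial.map_monomial, map_add, map_pow, dehomogenize_X,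
      dehomogenize_monomial]
  rw [hF]
  by_cases hj : lH = j
  · -- the `H`-chart: `1 + ā X^b`
    subst hj
    rw [killVar_self, one_pow]
    exact algebraMap_one_add_monomial_notMem_sq (b.subtypeDomain fun l => l ≠ lH) (Ideal.Quotient.mk (maximalIdeal R) a)
      ⟨l₁, hl₁⟩ (by rwa [Finsupp.subtypeDomain_apply]) 𝔮 (Localization.AtPrime 𝔮)
  · -- a `D`-chart off `V(H')`: `X_{l_H}ⁿ + ā X^b`, `X_{l_H} ∉ 𝔮`
    rw [killVar_of_ne j hj]
    exact algebraMap_X_pow_add_monomial_notMem_sq hnκ ⟨lH, hj⟩ (b.subtypeDomain fun l => l ≠ j)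
      (by rw [Finsupp.subtypeDomain_apply]; exact hblH) (Ideal.Quotient.mk (maximalIdeal R) a) 𝔮
      (h𝔮 ⟨lH, hj⟩ (Set.mem_singleton lH)) (Localization.AtPrime 𝔮)

set_option maxHeartbeats 400000 in
/-- **THE TAME GUARD.**  For a `ncHypShape n`-datum and the blow-up `π` of a face through `H` of weight `≥ n`: at every point `x'`
OVER THE CENTRE and OFF `V(H')` (any residue field), `𝓘'_{x'} ⊄ 𝔪_{x'}²` — the controlled transform has order `≤ 1` there.
Uses `¬ p ∣ n` through the stalk units `n ∈ 𝒪^×` of the shape (module docstring; WILD counterexample recorded there).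
[new] [cite: CossartPiltant2008, Prop. 4.2 (a)] [cite: Kollar2007, (3.111) Step 3] -/
theorem ncHypShape.not_stalkIdeal_transform_le_sq (hEs : HasSNC (H :: boundaryOf E)) (hT : ∀ K ∈ T, K ∈ H :: boundaryOf E)
    (hHT : H ∈ T) (hπ : IsBlowup π (T.sup id)) (hmT : n ≤ weightOf E T) (hP : ncHypShape n X E H M) {x' : X'}
    (hxC : π x' ∈ (T.sup id).support) (hx' : x' ∉ (strictTransformIdeal π (T.sup id) H).support) :
    ¬ stalkIdeal (M.transform π (T.sup id)).ideal x' ≤ maximalIdeal (X'.presheaf.stalk x') ^ 2 := by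
  classical
  haveI : IsProper π := hπ.isProper
  haveI : IsLocallyNoetherian X' := LocallyOfFiniteType.isLocallyNoetherian π
  obtain ⟨k, c, lH, b, a, hc, hcspan, hHc, hblH, hbn, hFJ⟩ := hP.exists_fibre_data hEs hT hHT hmT hxC
  rw [MarkedIdeal.transform_ideal, hP.mult_eq]
  refine IsBlowup.not_stalkIdeal_controlledTransform_le_pow_of_fibre hπ c hcspan (IsRsopPart.isQuasiRegular' hc)
    (IsRsopPart.mem_maximalIdeal hc) ((MvPolynomial.isHomogeneous_X_pow lH n).add (MvPolynomial.isHomogeneous_monomial _ hbn))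
    hFJ 2 {lH} (fun l hl => ?_) fun j 𝔮 _ h𝔮 => fibreForm_notMem_sq (hP.isUnit_natCast (π x')) lH b hblH hbn a j 𝔮 h𝔮
  rw [Set.mem_singleton_iff.mp hl]
  exact map_stalkIdeal_finsetSup_eq_span_of_not_mem hEs hT hHT hπ hx' hHc

end Fibre

end Summit.ResolutionOfSingularities.ResolutionOfSingularities.Theorems.DeltaCutClasses
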